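import Literature.Barriers.Parity.SiegelZeroDichotomyPairHLSixSlotEuler
import Literature.Barriers.Parity.SiegelZeroDichotomyPairHLMoebiusSlot
import HarnessLib

/-!
# Tao–Teräväinen 2022, §8 (`k = 2`): the pointwise main term from an Euler-product asymptotic

Topic `Literature/Barriers/Parity`, sub-namespace `TaoTeravainen`; assembly step of (8.8) in the proof
DAG of `Literature.Barriers.Parity.TaoTeravainen2021_prop72_81_pair` (T. Tao, J. Teräväinen, *The
Hardy–Littlewood–Chowla conjecture in the presence of a Siegel zero*, J. London Math. Soc. (2) 106
(2022), arXiv:2109.06291), end of §8: "we conclude that `∏_p E_{p,t} = 𝔖 log^{-k} x ∏_j (1+t_{0,j}) +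
O(log^{-k} x/log^{1/(7k)} η)`. Inserting this bound into (8.17), and using (8.14) to remove the restriction
(8.21), we can thus write the left-hand side of (8.8) as `≈ 𝔖 ∫ ∏_j (1+t_{0,j})F_j(t_{0,j}) f(t_{1,j})f(t_{2,j}) dt`.
Using (8.15), (8.16) we obtain (8.8) as desired."

Everything here is PROVED. The Euler-product asymptotic — the comparison of the kernel `K = ∏_{p∈P} E_p`
of `SiegelZeroDichotomyPairHLSixSlotEuler.lean` with `𝔖' ∏_j ∏_{p<N}(1 - p^{-s(τ_{j,0})})` — enters as an
explicit POINTWISE HYPOTHESIS `hK` with an integrable error (it is the subject of the local-factor files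
`SiegelZeroDichotomyPairHLMainTermLocal*.lean`); given it, this file performs the integration:

* `modelFactor` (`∏_{p<N}(1 - p^{-s(τ)})` in a `d`-slot, `1` in a sieve slot) and `npow_slotExpo_div_eq_cpow`
  (the kernel's `p^{s₀(τ)}/p` is `p^{-s(τ)}`, `s = 1 + 1/X − 2πiτ` of `…MoebiusSlot.lean`);
* `integral_model_mul_sixWeight` — `∫_{ℝ⁶} (∏_j M(τ_{j,0})) W(τ) dτ = m₁ m₂` with
  `m_j = ∫ ĝ_{c_j} M` (Fubini and `∫ f = 1`);
* **`norm_smoothPointwise_sub_le`** — `‖G(y) − 𝔖'‖ ≤ ε_K + ‖𝔖'‖ (ε₁ + ε₂ + ε₁ε₂)` where `ε_K` bounds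
  `∫ ‖K − 𝔖'∏M‖ ‖W‖` and `ε_j` bounds `‖m_j − 1‖` (from `…MoebiusSlot.lean`).
  [cite: TaoTeravainen2021, §8 (8.8), (8.17), (8.25), (8.15)–(8.16)]
-/

noncomputable section

open Finset Real MeasureTheory Complex
open scoped FourierTransform

namespace Literature.Barriers.Parity

namespace TaoTeravainen

variable {q : ℕ}

/-! ### The model factor -/

/-- The model slot factor: `∏_{p<N}(1 - p^{-s(τ)})` in a `d`-slot, `1` in a sieve slot.
[cite: TaoTeravainen2021, §8 (8.25) (the factor `∏_p ∏_j (1 - p^{-1-(1+it_{0,j})/log x})`)] -/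
def modelFactor (X : ℝ) (N : ℕ) (k : Slot) (τ : ℝ) : ℂ :=
  if k.2 = 0 then eulerTrunc N (zetaSlotS X τ) else 1

/-- **The kernel's `d`-slot unit is `p^{-s}`**: `npow(s₀(τ)) p / p = p^{-s(τ)}` for `p ≥ 1`.
[folklore] -/
theorem npow_slotExpo_div_eq_cpow (X R : ℝ) (j : Fin 2) (τ : ℝ) {p : ℕ} (hp : 0 < p) :
    npow (slotExpo X R (j, 0) τ) p / p = ((p : ℂ)) ^ (-zetaSlotS X τ) := by
  rw [natCast_cpow_neg_zetaSlotS hp]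
  unfold npow slotExpo
  simp only [if_true]
  have hp0 : (p : ℂ) ≠ 0 := by exact_mod_cast hp.ne'
  rw [div_eq_mul_inv, show ((p : ℂ))⁻¹ = (((p : ℝ)⁻¹ : ℝ) : ℂ) by push_cast; rfl]
  rw [mul_comm, mul_assoc, ← Complex.exp_add]
  congr 1
  push_cast
  ring

/-! ### Fubini for the model -/

/-- The integrands of the model are integrable in each slot. [folklore] -/
theorem integrable_modelFactor_mul {φ ψ : ℝ → ℝ} (hφ : IsBump φ) (hψ : IsSmoothCutoff ψ) {X U₀ : ℝ}
    (hU₀ : 1 ≤ U₀) (hX : 2 * U₀ + 2 ≤ X) (h₁ h₂ : ℕ) {y : ℝ}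
    (hc : ∀ j : Fin 2, Real.log (y + (if j = 0 then h₁ else h₂ : ℕ)) ≤ X + 1) (N : ℕ) (k : Slot) :
    Integrable fun τ : ℝ => modelFactor X N k τ * slotTransform φ ψ X U₀ h₁ h₂ y k τ := by
  have hX0 : 0 < X := by linarith
  unfold modelFactor slotTransform
  by_cases hk : k.2 = 0
  · simp only [hk, if_true]
    have hF := (integrable_psiFourier hφ hψ hU₀ hX (hc k.1)).1
    have hcont : Continuous fun τ : ℝ => eulerTrunc N (zetaSlotS X τ) := by
      unfold eulerTrunc
      refine continuous_finsetProd _ fun p hp => continuous_const.sub ?_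
      exact continuous_const.cpow (continuous_zetaSlotS X).neg fun τ => Or.inl (by
        exact_mod_cast (Nat.prime_of_mem_primesBelow hp).pos)
    refine hF.bdd_mul (c := Real.exp (1 + 1 / X⁻¹)) hcont.aestronglyMeasurable (ae_of_all _ fun τ => ?_)
    have h := norm_eulerTrunc_le (s := zetaSlotS X τ) (by rw [re_zetaSlotS]; have := inv_pos.mpr hX0; linarith) N
    rw [re_zetaSlotS, add_sub_cancel_left] at h
    exact h
  · simp only [hk, if_false, one_mul]
    exact integrable_sieveFourier hψ

/-- **Fubini for the model**: `∫_{ℝ⁶} (∏_k M_k(τ_k)) W(τ) dτ = m₁ m₂`, `m_j = ∫ ĝ_{c_j}(τ) ∏_{p<N}(1-p^{-s(τ)}) dτ`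
(the four sieve slots integrate to `∫ f = 1`). [cite: TaoTeravainen2021, §8 ((8.15): "`∫ f = 1`")] -/
theorem integral_model_mul_sixWeight (φ : ℝ → ℝ) {ψ : ℝ → ℝ} (hψ : IsSmoothCutoff ψ) (X U₀ : ℝ)
    (h₁ h₂ : ℕ) (y : ℝ) (N : ℕ) :
    ∫ τ : Slot → ℝ, (∏ k : Slot, modelFactor X N k (τ k)) * sixWeight φ ψ X U₀ h₁ h₂ y τ =
      (∫ τ : ℝ, psiFourier φ ψ X U₀ (Real.log (y + h₁)) τ * eulerTrunc N (zetaSlotS X τ)) *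
        ∫ τ : ℝ, psiFourier φ ψ X U₀ (Real.log (y + h₂)) τ * eulerTrunc N (zetaSlotS X τ) := by
  unfold sixWeight
  have h1 : ∫ τ : Slot → ℝ, (∏ k : Slot, modelFactor X N k (τ k)) * ∏ k : Slot, slotTransform φ ψ X U₀ h₁ h₂ y k (τ k) =
      ∫ τ : Slot → ℝ, ∏ k : Slot, (modelFactor X N k (τ k) * slotTransform φ ψ X U₀ h₁ h₂ y k (τ k)) :=
    integral_congr_ae (ae_of_all _ fun τ => by beta_reduce; rw [prod_mul_distrib])
  rw [h1, integral_fintype_prod_volume_eq_prod (𝕜 := ℂ)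
    (fun k τ => modelFactor X N k τ * slotTransform φ ψ X U₀ h₁ h₂ y k τ)]
  rw [Fintype.prod_prod_type, Fin.prod_univ_two, Fin.prod_univ_three, Fin.prod_univ_three]
  simp only [modelFactor, slotTransform, Fin.isValue, if_true, show ((1 : Fin 3) = 0) = False by decide,
    show ((2 : Fin 3) = 0) = False by decide, if_false, show ((1 : Fin 2) = 0) = False by decide, one_mul,
    integral_sieveFourier hψ, mul_one]
  congr 1
  · exact integral_congr_ae (ae_of_all _ fun τ => by ring)
  · exact integral_congr_ae (ae_of_all _ fun τ => by ring)

/-! ### The pointwise main term -/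

/-- **The pointwise main term from an Euler-product asymptotic.** Suppose the kernel satisfies
`‖K(τ) − 𝔖' ∏_j ∏_{p<N}(1 − p^{-s(τ_{j,0})})‖ ≤ err(τ)` for all `τ`, with `err · ‖W‖` integrable of integral
`≤ ε_K`, and the two Möbius slots satisfy `‖m_j − 1‖ ≤ ε_j`. Then
`‖∫ K W − 𝔖'‖ ≤ ε_K + ‖𝔖'‖ (ε₁ + ε₂ + ε₁ε₂)`. Combined with `smoothPointwise_eq_integral` this is (8.8)
at one `y`. [cite: TaoTeravainen2021, §8 (8.8), (8.25), (8.15)–(8.16)] -/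
theorem norm_integral_kernel_sub_le {φ ψ : ℝ → ℝ} (hφ : IsBump φ) (hψ : IsSmoothCutoff ψ) {X U₀ : ℝ}
    (hU₀ : 1 ≤ U₀) (hX : 2 * U₀ + 2 ≤ X) (h₁ h₂ : ℕ) {y : ℝ}
    (hc : ∀ j : Fin 2, Real.log (y + (if j = 0 then h₁ else h₂ : ℕ)) ≤ X + 1) (N : ℕ)
    {K : (Slot → ℝ) → ℂ} (hKW : Integrable fun τ => K τ * sixWeight φ ψ X U₀ h₁ h₂ y τ) {S' : ℂ}
    {err : (Slot → ℝ) → ℝ} (herrW : Integrable fun τ => err τ * ‖sixWeight φ ψ X U₀ h₁ h₂ y τ‖)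
    (hK : ∀ τ, ‖K τ - S' * ∏ j : Fin 2, eulerTrunc N (zetaSlotS X (τ (j, 0)))‖ ≤ err τ) {εK ε₁ ε₂ : ℝ}
    (hεK : ∫ τ, err τ * ‖sixWeight φ ψ X U₀ h₁ h₂ y τ‖ ≤ εK)
    (hm₁ : ‖(∫ τ : ℝ, psiFourier φ ψ X U₀ (Real.log (y + h₁)) τ * eulerTrunc N (zetaSlotS X τ)) - 1‖ ≤ ε₁)
    (hm₂ : ‖(∫ τ : ℝ, psiFourier φ ψ X U₀ (Real.log (y + h₂)) τ * eulerTrunc N (zetaSlotS X τ)) - 1‖ ≤ ε₂) :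
    ‖(∫ τ : Slot → ℝ, K τ * sixWeight φ ψ X U₀ h₁ h₂ y τ) - S'‖ ≤ εK + ‖S'‖ * (ε₁ + ε₂ + ε₁ * ε₂) := by
  set W := sixWeight φ ψ X U₀ h₁ h₂ y with hW
  set m₁ := ∫ τ : ℝ, psiFourier φ ψ X U₀ (Real.log (y + h₁)) τ * eulerTrunc N (zetaSlotS X τ) with hm₁def
  set m₂ := ∫ τ : ℝ, psiFourier φ ψ X U₀ (Real.log (y + h₂)) τ * eulerTrunc N (zetaSlotS X τ) with hm₂def
  have hε₁0 : 0 ≤ ε₁ := (norm_nonneg _).trans hm₁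
  have hε₂0 : 0 ≤ ε₂ := (norm_nonneg _).trans hm₂
  -- the model part integrates to `m₁ m₂`
  have hmodel_eq : ∀ τ : Slot → ℝ, (∏ j : Fin 2, eulerTrunc N (zetaSlotS X (τ (j, 0)))) =
      ∏ k : Slot, modelFactor X N k (τ k) := by
    intro τ
    rw [Fintype.prod_prod_type]
    refine prod_congr rfl fun j _ => ?_
    rw [Fin.prod_univ_three]
    simp [modelFactor]
  have hmodel_int : Integrable fun τ : Slot → ℝ => (∏ k : Slot, modelFactor X N k (τ k)) * W τ := by
    have h : Integrable (fun τ : Slot → ℝ => ∏ k : Slot,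
        (modelFactor X N k (τ k) * slotTransform φ ψ X U₀ h₁ h₂ y k (τ k)))
        (Measure.pi fun _ : Slot => (volume : Measure ℝ)) :=
      Integrable.fintype_prod (f := fun k τ => modelFactor X N k τ * slotTransform φ ψ X U₀ h₁ h₂ y k τ)
        fun k => integrable_modelFactor_mul hφ hψ hU₀ hX h₁ h₂ hc N k
    rw [← volume_pi] at h
    refine h.congr (ae_of_all _ fun τ => ?_)
    simp only [hW, sixWeight]
    rw [prod_mul_distrib]
  have hmain : (∫ τ : Slot → ℝ, K τ * W τ) - S' * (m₁ * m₂) =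
      ∫ τ : Slot → ℝ, (K τ - S' * ∏ j : Fin 2, eulerTrunc N (zetaSlotS X (τ (j, 0)))) * W τ := by
    rw [hm₁def, hm₂def, ← integral_model_mul_sixWeight φ hψ X U₀ h₁ h₂ y N, ← hW, ← integral_const_mul,
      ← integral_sub hKW (hmodel_int.const_mul S')]
    refine integral_congr_ae (ae_of_all _ fun τ => ?_)
    beta_reduce
    rw [hmodel_eq]; ring
  -- bound the difference integral
  have hdiff : ‖(∫ τ : Slot → ℝ, K τ * W τ) - S' * (m₁ * m₂)‖ ≤ εK := by
    rw [hmain]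
    refine (norm_integral_le_of_norm_le herrW (ae_of_all _ fun τ => ?_)).trans hεK
    rw [norm_mul]
    exact mul_le_mul_of_nonneg_right (hK τ) (norm_nonneg _)
  -- `‖m₁ m₂ − 1‖ ≤ ε₁ + ε₂ + ε₁ε₂`
  have hmm : ‖m₁ * m₂ - 1‖ ≤ ε₁ + ε₂ + ε₁ * ε₂ := by
    have : m₁ * m₂ - 1 = (m₁ - 1) * (m₂ - 1) + (m₁ - 1) + (m₂ - 1) := by ring
    rw [this]
    calc ‖(m₁ - 1) * (m₂ - 1) + (m₁ - 1) + (m₂ - 1)‖ ≤ ‖(m₁ - 1) * (m₂ - 1)‖ + ‖m₁ - 1‖ + ‖m₂ - 1‖ :=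
          (norm_add_le _ _).trans (add_le_add (norm_add_le _ _) le_rfl)
      _ ≤ ε₁ * ε₂ + ε₁ + ε₂ := by rw [norm_mul]; gcongr
      _ = ε₁ + ε₂ + ε₁ * ε₂ := by ring
  calc ‖(∫ τ : Slot → ℝ, K τ * W τ) - S'‖
      = ‖((∫ τ : Slot → ℝ, K τ * W τ) - S' * (m₁ * m₂)) + S' * (m₁ * m₂ - 1)‖ := by ring_nf
    _ ≤ ‖(∫ τ : Slot → ℝ, K τ * W τ) - S' * (m₁ * m₂)‖ + ‖S' * (m₁ * m₂ - 1)‖ := norm_add_le _ _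
    _ ≤ εK + ‖S'‖ * (ε₁ + ε₂ + ε₁ * ε₂) := by
        rw [norm_mul]; exact add_le_add hdiff (mul_le_mul_of_nonneg_left hmm (norm_nonneg _))

end TaoTeravainen

end Literature.Barriers.Parity
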